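import Mathlib
import HarnessLib
import HarnessLib.Audit
import Summits.Parity.Statement
import HarnessLib.Audit.Status.Attr

/-!
Route: ClassVarianceLadder

DORMANT since 2026-08-25T12:46:07Z (reconciler: no traction for 7.7 d (last activity item-evidence-added at 2026-08-17T19:15:04Z); parked, not closed — `ledger route dormant route-Parity-ClassVarianceLadder --off` to reactivate) — unstaffed, not closed; items shared with open routes are served there. `ledger route dormant <id> --off` reactivates.

# Route ClassVarianceLadder — Cauchy–Schwarz in the modulus, form by form — Möbius-free class
variance of prime tuples + the power-dilated Möbius cofactor atom decide GHL via the quantitative d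
= 1 ladder and the tree's proved fibration lemma; polylog co-level survives only at fixed shift

Card poisson-variance-polylog-atom (spine), redrawn so that the line DECIDES the sub-problem. Open
ONE von Mangoldt factor of a non-degenerate d = 1 system Ψ = (ψ₁,…,ψ_{t+1}) of size ‖Ψ‖_N ≤ L:
Λ(ψ_{t+1}(n)) = Σ_{dm = ψ_{t+1}(n)} μ(d) log m, so that the prime (t+1)-tuple sum over an interval K
⊆ [−N, N] is exactly (ATOM: dilations m ≤ N^δ) + Σ_{d ≤ 2L·N^{1−δ}} μ(d)·F_d, where F_d is the
log-weighted count of prime t-tuples of the sub-system Φ = (ψ₁,…,ψ_t) in the ONE residue class n ≡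
c_d (mod d) cut out by d | ψ_{t+1}(n). The main terms are pure Möbius sums (Σ_d μ(d)g(d)/d → 0, −Σ_d
μ(d)g(d) log d/d → Π_p β_p(Ψ)/β_p(Φ), g multiplicative, g(p) = p/(p−t) off the primes dividing a_i
or Δ_ij = a_i b_j − a_j b_i) and give β_∞·𝔖(Ψ) unconditionally at PNT rate, uniformly in the shifts;
the fluctuations are killed dyadic block by block by CAUCHY–SCHWARZ ACROSS THE MODULI, |Σ_{d∼D}
μ(d)·Fluct_d| ≤ 2 log(2LN)·√D·√V_t(D), which throws the Möbius signs away and lands on a MÖBIUS-FREE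
and HL-FREE mean square V_t(D) = Σ_{q∼D, q squarefree} sup_{I ⊆ [−N,N]} |T_q(Φ; I; c_q) − ρ_Φ(q,
c_q)·T_1(Φ; I)|², T_q = Σ_{n∈I, n≡c (q)} Π_i Λ(ψ_i(n)), ρ_Φ(q, c) = 1[c is q-admissible] /
#{q-admissible residues} — prime t-tuples in one class per modulus measured against their RELATIVE
density among admissible classes (no singular series, no Möbius). It suffices to show X = X₁ ∧ X₂ ∧
X₃ (all typed, Sketch rc 0): X₁ (MobiusCofactorAtom, rank 2): for every t ≥ 1, L, A there is δ > 0
with Σ_{m ≤ N^δ} log m·|Σ_{n∈I, m | ψ_{t+1}(n) ≥ 1} μ(ψ_{t+1}(n)/m)·Π_{i≤t} Λ(ψ_i(n))| ≤ N(log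
N)^{−A}, uniformly in ‖Ψ‖_N ≤ L and I — Möbius of the COFACTOR of the opened form does not see the
primality of the other forms; X₂ (PrimeClassVariance, rank 3): V_1(D) ≤ N²/(D(log N)^A) for all 1 ≤
D ≤ N^{1−ε}, every class function c and interval choice — primes in ONE class per modulus in mean
square, Elliott–Halberstam strength in one-class L² dress (EH ⟹ X₂, and X₂ ⟹ EH over squarefree
moduli by Cauchy–Schwarz in the class: refuter/grounder on stmt-Parity-13834, 2026-08-15; D ≤ √N(log
N)^{−B} is Bombieri–Vinogradov, proved in the tree); X₃ (TupleClassVariance, rank 4): the same for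
prime t-tuples, t ≥ 2. Induction on t (support LadderStep: Q_t ∧ V_t ∧ At_t ⟹ Q_{t+1}, provable
bookkeeping; LadderBase: Q_1 = PNT in progressions of bounded modulus) yields quantitative
Dickson–Hardy–Littlewood Q_t (saving every (log N)^{−A}) for every t, hence
GeneralizedHardyLittlewood through the ONE exit support QuantToGHL (stmt-Parity-18167, provable now:
A = 1, N ≥ exp(1/ε) give Green–Tao Conj. 1.2 at d = 1 with error εN, then the tree's PROVED
Theses-free fibration lemma FibrationGlue.generalizedHardyLittlewood_of_dimOne of
Theorems/LeeYangFibresFibrationLemmaFinal — cited by the prover's Theorems file, never imported by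
this route file; candidate proof rc 0 attached as evidence). The deciding theorem `closes` is
Nat.le_induction (glue.lean, lean check rc 0; six binders since route-repair rev 2). WHY A POWER
CO-LEVEL: the card's polylog co-level is right for a FIXED shift (Poisson-size fixed-residue
variance up to co-level (log x)^3 plus the (log x)^3-dilated Λ-weighted atom ⟹ PairsHL(h) — the
former context support FixedShiftPolylogExit, dropped at rev 2 as not load-bearing, its content kept
in NUMBERS), but it cannot survive the shift-uniformity |b_i| ≤ LN that Conj. 1.2 demands:
Friedlander–Granville 1989, Thm 1 (Maier matrix; one residue a = a(x) < x, a multiple of the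
primorial P(z) of the construction, serves all moduli at once) gives Σ_{T<q<4T,(q,a)=1} |ψ(x;q,a) −
x/φ(q)| ≫ x/log log x at T = x/(4 log^B x) for EVERY B, i.e. V ≫ x²/(T(log log x)²) for the pair
system (n, n − a): Cauchy–Schwarz in the modulus loses at every polylog co-scale for those shifts
(HL itself survives only through the Möbius signs CS discards). So the uniform ladder cuts at d ≤
N^{1−δ}, where the class variance is EH's shadow and no catalogued irregularity (FG 1989/1992, FGHM
1991, Granville–Soundararajan 2007: all at x/q ≤ exp((log x)^{1/2})) reaches.
Lean: `(∀ t : ℕ, 1 ≤ t → ∀ (L : ℕ) (A : ℝ), 0 < A → ∃ δ : ℝ, 0 < δ ∧ ∃ N₀ : ℕ, ∀ N : ℕ, N₀ ≤ N → ∀ Ψ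
: Fin (t + 1) → Literature.NumberTheory.Sieve.AffLinForm 1,
Literature.NumberTheory.Sieve.IsNondegenerateSystem Ψ → Literature.NumberTheory.Sieve.affLinSize Ψ N
≤ L → ∀ u v : ℤ, -(N : ℤ) ≤ u → v ≤ N → ∑ m ∈ Finset.Icc 1 ⌊(N : ℝ) ^ δ⌋₊, Real.log m * |∑ n ∈
(Finset.Icc u v).filter (fun n : ℤ => 1 ≤ (Ψ (Fin.last t)).eval (fun _ => n) ∧ (m : ℤ) ∣ (Ψ
(Fin.last t)).eval (fun _ => n)), (ArithmeticFunction.moebius (((Ψ (Fin.last t)).eval (fun _ =>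
n)).toNat / m) : ℝ) * ∏ i : Fin t, Literature.NumberTheory.Sieve.intVonMangoldt ((Ψ (Fin.castSucc
i)).eval fun _ => n)| ≤ (N : ℝ) / Real.log N ^ A) ∧ (∀ (L : ℕ) (A ε : ℝ), 0 < A → 0 < ε → ∃ N₀ : ℕ,
∀ N : ℕ, N₀ ≤ N → ∀ Φ : Fin 1 → Literature.NumberTheory.Sieve.AffLinForm 1,
Literature.NumberTheory.Sieve.IsNondegenerateSystem Φ → Literature.NumberTheory.Sieve.affLinSize Φ N
≤ L → ∀ D : ℝ, 1 ≤ D → D ≤ (N : ℝ) ^ (1 - ε) → ∀ c u v : ℕ → ℤ, (∀ q, -(N : ℤ) ≤ u q ∧ v q ≤ N) → ∑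
q ∈ (Finset.Ioc ⌊D⌋₊ ⌊2 * D⌋₊).filter Squarefree, ((∑ n ∈ (Finset.Icc (u q) (v q)).filter (fun n : ℤ
=> ((q : ℕ) : ℤ) ∣ n - (c q)), ∏ i, Literature.NumberTheory.Sieve.intVonMangoldt ((Φ i).eval fun _
=> n)) - ((if ∀ i, Int.gcd ((Φ i).eval fun _ => (c q)) q = 1 then (1 : ℝ) else 0) / ((((Finset.range
q).filter fun r : ℕ => ∀ i, Int.gcd ((Φ i).eval fun _ => (r : ℤ)) q = 1).card : ℕ) : ℝ)) * (∑ n ∈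
Finset.Icc (u q) (v q), ∏ i, Literature.NumberTheory.Sieve.intVonMangoldt ((Φ i).eval fun _ => n)))
^ 2 ≤ (N : ℝ) ^ 2 / (D * Real.log N ^ A)) ∧ (∀ t : ℕ, 2 ≤ t → ∀ (L : ℕ) (A ε : ℝ), 0 < A → 0 < ε → ∃
N₀ : ℕ, ∀ N : ℕ, N₀ ≤ N → ∀ Φ : Fin t → Literature.NumberTheory.Sieve.AffLinForm 1,
Literature.NumberTheory.Sieve.IsNondegenerateSystem Φ → Literature.NumberTheory.Sieve.affLinSize Φ N
≤ L → ∀ D : ℝ, 1 ≤ D → D ≤ (N : ℝ) ^ (1 - ε) → ∀ c u v : ℕ → ℤ, (∀ q, -(N : ℤ) ≤ u q ∧ v q ≤ N) → ∑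
q ∈ (Finset.Ioc ⌊D⌋₊ ⌊2 * D⌋₊).filter Squarefree, ((∑ n ∈ (Finset.Icc (u q) (v q)).filter (fun n : ℤ
=> ((q : ℕ) : ℤ) ∣ n - (c q)), ∏ i, Literature.NumberTheory.Sieve.intVonMangoldt ((Φ i).eval fun _
=> n)) - ((if ∀ i, Int.gcd ((Φ i).eval fun _ => (c q)) q = 1 then (1 : ℝ) else 0) / ((((Finset.range
q).filter fun r : ℕ => ∀ i, Int.gcd ((Φ i).eval fun _ => (r : ℤ)) q = 1).card : ℕ) : ℝ)) * (∑ n ∈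
Finset.Icc (u q) (v q), ∏ i, Literature.NumberTheory.Sieve.intVonMangoldt ((Φ i).eval fun _ => n)))
^ 2 ≤ (N : ℝ) ^ 2 / (D * Real.log N ^ A))`

## Assembly
Pure logic given the items (glue.lean, `lean check` rc 0, sorries 0; hypotheses = the six decls
MobiusCofactorAtom, PrimeClassVariance, TupleClassVariance, LadderStep, LadderBase, QuantToGHL,
conclusion = the sub-problem Statement `GeneralizedHardyLittlewood` by name): `closes hAt hV1 hVt
hStep hBase hQG := hQG (fun t ht => Nat.le_induction hBase (fun k hk ih => hStep k hk ih (V_k from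
hV1 if k = 1, from hVt k if 2 ≤ k) (hAt k hk)) t ht)` — induction on the number of forms with the
quantitative statement Q_t as currency: LadderBase is Q_1; LadderStep turns Q_k, the class variance
at k (PrimeClassVariance for k = 1, TupleClassVariance for k ≥ 2) and the atom at k into Q_{k+1};
QuantToGHL drops the log-power saving to o(N) and fibres general (d, t, L, K) over d = 1 through the
tree's proved fibration lemma. ROUTE-REPAIR rev 2 (2026-08-17): DimOne (stmt-Parity-0819, the shared
d = 1 conjecture; it was a rank-0 target here, never a binder of `closes`, and its DicksonFibration
skeleton stub is summit-equivalent — skeleton.hides-summit) and FibrationLemma (stmt-Parity-0822,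
proved; its `_holds` link auto-imported Theorems/LeeYangFibresAssemblyClose, a 114-module cone
carrying 11 unproved named facts of RHWave0 / LevelOfDistribution / Transference) are no longer
items of this route, nor are QuantToDimOne (folded into QuantToGHL) and the two out-of-cone context
supports EHGivesPrimeClassVariance / FixedShiftPolylogExit. All mathematics sits in the items; every
item is stated over Mathlib + Literature.NumberTheory.Sieve.LinearEquationsInPrimes (via the
Statement); the route file imports nothing beyond the gate defaults and no decl uses an unproved
Literature fact (the Statement module's co-located HardyLittlewoodConjE / BatemanHornConjecture /
GeneralizedHardyLittlewoodCount / GreenTaoZiegler2012_finiteComplexity are never hypotheses).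

Rationale: WHY THIS LINE. Mechanism: one Cauchy–Schwarz inequality in the modulus (card
poisson-variance-polylog-atom) turns the level-of-distribution half of the Bombieri / Murty–Vatwani
opening (BombieriAsymptoticSieve1976; MurtyVatwani2017, Vatwani2016 ch. 7, Murty's survey p. 3:
'even admitting EH the interval [x^{1−ε}, x] still needs to be treated') into a statement with NO
Möbius function and NO singular series in it — a mean square, over the moduli, of prime tuples in
ONE residue class against their relative density (the object of Hooley1975BDH1/Hooley1977BDH7,
Montgomery1971 ch. 17, FriedlanderGoldston1996 on the all-classes side and of the fixed-class
dispersion technology BombieriFriedlanderIwaniecActa1986, BombieriFriedlanderIwaniec1987,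
Maynard2020LargeModuliI, DrappeauFiorilli2020 for first moments) — and leaves ALL parity content in
the Möbius-cofactor atom, the power-dilated, tuple-weighted, shift-uniform form of
Literature.NumberTheory.Sieve.MoebiusShiftedPrimesConjecture (Lichtman2020, LichtmanTeravainen2022,
Harman2007 §14.2). Imported areas: the probabilistic (Cramér / Montgomery–Hooley) model of primes in
progressions supplies the size and plausibility of X₂/X₃; large-sieve / dispersion theory supplies
their L²-over-moduli form; multiplicative number theory (Chowla–Elliott–Sarnak circle) owns X₁; the
Maier-matrix irregularity theory (FriedlanderGranville1989, FriedlanderGranvilleHildebrandMaier1991,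
GranvilleSoundararajan2007Uncertainty; Maier–Rassias survey in the Pintz–Rassias volume, §4, read)
fixes the co-level. What prior routes do not do: MobiusShiftedPrimes (retired) needed
Elliott–Halberstam itself (max over classes, L¹) and stopped at pairs with h = 2;
PoissonVarianceAtom (gen-1 of this card, retired not-a-thesis) stopped at PairsHL;
RoughSemiprimeRigidity reaches GHL only through the declared GHL-hard residual PairsToGHL; here
every hypothesis below the co-level is Möbius-free AND Hardy–Littlewood-free for every number of
forms, the induction on t is typed, and `closes` reaches GeneralizedHardyLittlewood through the
tree's PROVED fibration lemma (inside the exit support QuantToGHL) — no residual. Negatives index (2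
entries) untouched.

RANKED CRUXES. #2 MobiusCofactorAtom (crux) — (card Crux 2, made shift-uniform, tuple-weighted and
power-dilated) for every t ≥ 1, L and A > 0 there are δ > 0 and N₀ such that for N ≥ N₀, every
non-degenerate system Ψ of t+1 affine forms on ℤ with ‖Ψ‖_N ≤ L and every integer interval [u,v] ⊆
[−N,N]: Σ_{1 ≤ m ≤ N^δ} log m·|Σ_{n∈[u,v], ψ_{t+1}(n) ≥ 1, m | ψ_{t+1}(n)} μ(ψ_{t+1}(n)/m)·Π_{i≤t}
Λ(ψ_i(n))| ≤ N/(log N)^A (m = 1 carries weight log 1 = 0). The Möbius function of the COFACTOR of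
the opened form does not correlate with primality of the other t forms, ℓ¹ over dilations m ≤ N^δ:
trivial mass ≍ δ²N(log N)²/2, so the demand is a (log N)^{A+2} saving; t = 1, Ψ = (n, n+h) is
Σ_{m≤N^δ} log m |Σ_{p≤N, m | p+h} μ((p+h)/m) log p| — the 0613/M_avg shape of MobiusShiftedPrimes,
quantitative and uniform in |h| ≤ LN. [difficulty: open-problem] (why it might fail: It is
Möbius-on-shifted-primes (open for every single m, h; Lichtman2020 only on average over shifts) for
tuples, log-power saving, UNIFORM in shifts ≤ LN: under an exceptional zero mod q it fails at h ≡ 0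
(q) (μ(d) ≈ −χ̄(m) along dm+h prime), so a proof entails Landau–Siegel repulsion.)
[Literature.NumberTheory.Sieve.MoebiusShiftedPrimesConjecture, MurtyVatwani2017, Vatwani2016,
Lichtman2020, LichtmanTeravainen2022, Harman2007, HeathBrown1983PrimeTwins, MatomakiMerikoski2023,
Karatsuba1995, Literature.Barriers.Parity.PrimePairParity,
Literature.Barriers.Parity.SiegelZeroPrimePairBarrier]
#3 PrimeClassVariance (crux) — (card Crux 1 at the power co-level forced by shift-uniformity) for
every L, A, ε > 0, eventually in N, for every non-degenerate one-form system φ(n) = a n + b (a ≠ 0,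
|a| + |b|/N ≤ L), every scale 1 ≤ D ≤ N^{1−ε}, every class function c and interval choice [u_q, v_q]
⊆ [−N,N]: Σ_{D<q≤2D, q squarefree} (Σ_{n∈[u_q,v_q], n≡c_q (q)} Λ(an+b) − ρ_φ(q,c_q)·Σ_{n∈[u_q,v_q]}
Λ(an+b))² ≤ N²/(D(log N)^A), where ρ_φ(q,c) = 1[gcd(ac+b,q)=1]/#{r mod q : gcd(ar+b,q)=1} (=
φ(|a|)/φ(|a|q) on coprime classes). Primes in ONE residue class per modulus, in mean square over the
moduli, to level N^{1−ε}: 'Barban–Davenport–Halberstam for a worst class', Möbius-free; as typed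
(every class function, every A) it is Cauchy–Schwarz-EQUIVALENT to Elliott–Halberstam over
squarefree moduli (EH ⟹ this with one Siegel–Walfisz step; this ⟹ Σ_{q∼D sqfree} max_a |E| ≤ √D·√V ≤
N(log N)^{−A/2}: refuter evidence Evidence_stmt-Parity-13834.md and grounder g27-24, 2026-08-15),
known for D ≤ √N(log N)^{−B} from Bombieri–Vinogradov (tree, proved). [difficulty: open-problem]
(why it might fail: ≍ Elliott–Halberstam over squarefree moduli (refuter 13834): nothing is known
for a worst class beyond √N(log N)^{−B}; BFI x^{4/7} / Maynard x^{3/5} give signed, well-factorable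
first moments for a FIXED residue only; at D = N^θ it is HL in signed aggregate over a 2-slope
family of size N^{2(1−θ)} < N.) [ElliottHalberstam1970, Hooley1975BDH1, Hooley1977BDH7,
Montgomery1971, FriedlanderGoldston1996, BombieriFriedlanderIwaniecActa1986,
BombieriFriedlanderIwaniec1987, Maynard2020LargeModuliI, DrappeauFiorilli2020,
FriedlanderGranville1989, Literature.Barriers.Parity.LargeSieveLevelHalf]
#4 TupleClassVariance (crux) — for every t ≥ 2 the same relative mean square for prime t-tuples: for
every L, A, ε > 0, eventually in N, for every non-degenerate d = 1 system Φ of t forms with ‖Φ‖_N ≤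
L, every 1 ≤ D ≤ N^{1−ε}, every class function c and intervals [u_q,v_q] ⊆ [−N,N]: Σ_{D<q≤2D, q
squarefree} (T_q(c_q) − ρ_Φ(q,c_q)·T_1)² ≤ N²/(D(log N)^A), T_q(c) = Σ_{n∈[u_q,v_q], n≡c (q)} Π_i
Λ(φ_i(n)), ρ_Φ(q,c) = 1[∀i gcd(φ_i(c),q)=1]/#{r mod q : ∀i gcd(φ_i(r),q)=1}. HL-FREE (the actual
tuple count T_1 on the same interval is the reference, not β_∞𝔖) and Möbius-free: 'prime t-tuples
are equidistributed among the q-admissible classes, in L² over q ∼ D, for all D ≤ N^{1−ε}' — the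
Siegel–Walfisz, Bombieri–Vinogradov and Elliott–Halberstam ranges for tuples at once, in the weakest
(one class, L², relative) form the ladder needs; the HL main terms are EXACTLY uniform over
admissible classes (β_ℓ of the composed system n ↦ Φ(qn+c) is independent of the admissible c), so
no singular-series correction is hidden. [deps: PrimeClassVariance] [difficulty: open-problem] (why
it might fail: Equidistribution of ACTUAL prime t-tuples among admissible classes is unknown at ANY
growing modulus, even q ≤ log N for twins (no Siegel–Walfisz/BV for pairs); only the exact
class-symmetry of the HL main terms and shift-averaged results (Kawada, MRT2019 with H ≥ X^{8/33})
support it.) [GreenTao2010, Dickson1904, Kawada1995, MatomakiRadziwillTao2019, Gallagher1976,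
GranvilleSoundararajan2007Uncertainty, Literature.Barriers.Parity.EquidistributionLimitBarrier]
#9 LadderStep (support) — PROVABLE bookkeeping (the card's CS reduction, for general t; est. XL in
Lean): for every t ≥ 1, Q_t → V_t → At_t → Q_{t+1}, where Q_t is quantitative Dickson–HL for t forms
(∀ L A ∃ N₀: |Σ_{n∈K}ΠΛ(φ_i(n)) − β_∞𝔖(Φ)| ≤ N/(log N)^A uniformly), V_t the class variance
(PrimeClassVariance / TupleClassVariance body at t) and At_t the atom body at t. Proof plan: (i)
opening identity Λ = μ⋆log on the last form and the split m ≤ N^δ (atom, bounded by At_t at saving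
A+1) / d ≤ 2LN^{1−δ}; gcd(a_{t+1},b_{t+1}) > 1 ⇒ both sides ≪ (log N)^{t+2} (β_p = 0); else only d
coprime to a_{t+1} occur and {n : d | ψ_{t+1}(n)} is one class c_d mod d; (ii) F_d = ρ(d,c_d)·G_d +
Fluct_d with G_d the log-weighted full t-tuple sum, evaluated by Q_t (saving 2A+8) and partial
summation; (iii) main term Σ_d μ(d)ρ(d,c_d)G_d = β_∞𝔖(Ψ) + O(N(log N)^{−A−1}) by the multiplicative
identity g(d) = d·ρ(d,c_d), Σ_{d≤y} μ(d)g(d)/d ≪ (log y)^{−B} and −Σ_d μ(d)g(d)log d/d = Π_p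
β_p(Ψ)/β_p(Φ) (generic factor (1 − 1/(p−t))·p/(p−1) = β_p(Ψ)/β_p(Φ), checked), PNT-rate Möbius sums
twisted by the tame g uniformly in the ≤ t² log(LN) exceptional primes (tree:
SiegelWalfiszMoebius_holds, tendsto_singularProductPartial_holds); (iv) |Fluct_d| ≤ 2 log(2LN)·sup_I
|T_d(I;c_d) − ρ T_1(I)| by partial summation of the monotone weight log(ψ_{t+1}(n)/d);
Cauchy–Schwarz on each dyadic block D ≤ 2LN^{1−δ} with V_t at ε = δ/2 and saving 2A+6: ≤ 2 log² N
blocks·terms ≤ N(log N)^{−A−1}. [difficulty: XL] [BombieriAsymptoticSieve1976, MurtyVatwani2017,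
Vatwani2019, IwaniecKowalski2004, GreenTao2010]
#9 LadderBase (support) — Q_1, PROVABLE NOW (est. M): for one non-constant form an + b with |a| +
|b|/N ≤ L and an interval K ⊆ [−N,N], |Σ_{n∈K∩ℤ} Λ(an+b) − vol(K ∩ {au+b > 0})·𝔖| ≤ N/(log N)^A
uniformly, 𝔖 = singularProduct of the one-form system = 1[gcd(a,b)=1]·|a|/φ(|a|) (β_p = 1 for p ∤ a,
p/(p−1) for p | a ∤ b, 0 for p | (a,b)): the prime number theorem for the progression b mod |a|
(bounded modulus ≤ L) on a value interval of length ≤ 2LN with error N·exp(−c√log N), from the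
tree's Siegel–Walfisz theorem (Literature.NumberTheory.LFunctions.siegel_walfisz_holds) plus the
evaluation of localFactor/singularProduct for t = 1 (tendsto_singularProductPartial_holds) and
archFactor = length of an interval. [difficulty: provable-now] [MontgomeryVaughan2007, GreenTao2010,
IwaniecKowalski2004]
#9 QuantToGHL (support, stmt-Parity-18167; replaces QuantToDimOne + FibrationLemma at rev 2) —
PROVABLE NOW (est. S; planner candidate proof attached, rc 0): quantitative Dickson–HL for every t
(∀ A, error ≤ N/(log N)^A) implies GeneralizedHardyLittlewood: take A = 1 and N ≥ exp(1/ε) for the d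
= 1 conjecture with error εN (grounder proof of the former QuantToDimOne, rc 0), then the tree's
proved Theses-free fibration lemma
Summit.Parity.GeneralizedHardyLittlewood.Theorems.FibrationGlue.generalizedHardyLittlewood_of_dimOne
(Theorems/LeeYangFibresFibrationLemmaFinal.lean: shear normalisation, convex fibres, CRT/Gallagher
averaging of fibre singular products, lattice points of convex bodies; GreenTao2010 §1 'holding d −
1 of the variables fixed and summing in the remaining one'). CONE HYGIENE: the prover's Theorems
file imports ONLY LeeYangFibresFibrationLemmaFinal (31-module cone; never LeeYangFibresAssemblyClose
= 114 modules with RHWave0 / LevelOfDistribution, never a Theses module), so this route file cites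
no theorem and imports nothing beyond the gate defaults. [difficulty: provable-now] [GreenTao2010]

TWO-LAYER PLAN. Foreseen glued splits (k ≤ 3, depth 1), none filed now. LadderStep ⇐
OpeningAndBlocks (identity + CS/partial-summation bookkeeping, L) → MainTermIdentity (Σ_d
μ(d)ρ(d,c_d)·weights = β_∞𝔖(Ψ) + O(N(log N)^{−A}), uniform tame-g Möbius sums, L) → LadderStep.
PrimeClassVariance ⇐ BVRange (1 ≤ D ≤ √N(log N)^{−B}: provable now from bombieri_vinogradov_holds +
Siegel–Walfisz) → DispersionWindow (√N(log N)^{−B} < D ≤ N^{1/2+η}: BFI-II / Maynard2020LargeModuliI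
range, ℓ¹→ℓ² upgrade is the bet) → Bulk (N^{1/2+η} < D ≤ N^{1−ε}: Hooley/Montgomery for one class =
HL on average over polynomially large 2-slope families, Kawada1995/Balog-type circle method as the
engine) → PrimeClassVariance. MobiusCofactorAtom ⇐ prime dilations m → composite m (Kátai /
Bourgain–Sarnak–Ziegler propagation μ(pm') = −μ(m'), card katai-propagation-shifted-primes) → glue.
TupleClassVariance ⇐ t = 2 (pairs, incl. twins/SG/Goldbach-in-the-shift) → general t.

KILL CRITERIA. Refutation of PrimeClassVariance at some power scale D = N^θ, θ < 1 (a
fixed-class-function mean-square Ω-theorem of Maier/FGHM type beyond exp((log x)^{1/2}) co-scales,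
or decisive kit numerics) closes the route `refuted:PrimeClassVariance` and refutes
Elliott–Halberstam itself (crux 3 ≍ EH over squarefree moduli). Refutation of MobiusCofactorAtom: if
by a collapsing window / edge system (misstated) ⇒ repair by a new item; if substantive (an
unconditional correlation between μ of an affine image and primality of the other forms) ⇒ the
Bombieri/Murty–Vatwani programme is dead for GHL and the route closes `refuted:MobiusCofactorAtom`.
Refutation of TupleClassVariance by a provable bias of prime t-tuples among admissible classes at
small q ⇒ pivot: restrict the class functions to the divisibility classes {n : d | ψ(n)} of forms of
size ≤ L (all the Step uses) via a repaired item. DimOne (stmt-Parity-0819, an item of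
DicksonFibration / PrimeDeterminantCells / HyperbolicConstellations / LeeYangFibres, no longer of
this route) proved on a sibling route closes the sub-problem outright through the proved fibration
lemma and moots this ladder; a proof of Landau–Siegel zeros' existence refutes the uniform atom (and
uniform GHL) at once.

NOT DECOMPOSED YET. The three lemmas inside LadderStep (opening/CS bookkeeping, main-term identity
with the exceptional primes p | a_i·Δ_ij, the t = 1 singular-product evaluation) and the regimes of
PrimeClassVariance (BV range provable now; dispersion window; bulk) are layer-2 children, filed only
when a prover asks; the Siegel-zero case analysis of the atom, the composite-dilation propagation,
any ℓ¹/well-factorable variant of the variance (BFI shape), and the d ≥ 2 fibration internals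
(DicksonFibration's business) are deliberately not decomposed. No conjectural item is split at open
(D-0019). DROPPED AT REV 2 (route-repair 2026-08-17, none load-bearing for `closes`): the rank-0
target copy of DimOne (stmt-Parity-0819; its DicksonFibration skeleton stub stub_twoFlatFactors is
summit-equivalent — skeleton.hides-summit — and this route never consumed the decl), the shared
proved FibrationLemma (stmt-Parity-0822; now inside QuantToGHL via the Theses-free theorem),
QuantToDimOne (stmt-Parity-13838; folded into QuantToGHL), and the context supports
EHGivesPrimeClassVariance (stmt-Parity-13839: EH ⟹ crux 3 — with the refuter's converse crux 3 ≍ EH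
over squarefree moduli, recorded on stmt-Parity-13834) and FixedShiftPolylogExit (stmt-Parity-13840:
fixed-residue Poisson variance to co-level (log x)^3 ∧ (log x)^3-dilated atom ⟹ PairsHL(h) per fixed
shift h — where the polylog co-level legitimately lives; content kept in NUMBERS and in the card).

CHEAPEST FALSIFIER. (i) kit numerics, t = 1 and t = 2: for φ = (n) and Φ = (n, n+2), N = 10^7…10^9,
D = N^θ, θ ∈ {0.5, 0.6, 0.7, 0.8, 0.9}, class functions c_q ∈ {1, −2, random admissible}: the
normalised variance D·Σ_{q∼D}|T_q − ρT_1|²/N² should fall like D(log N)^{t}/N (Poisson); growth in θ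
at fixed N beyond that refutes cruxes 3/4 empirically. (ii) atom numerics, t = 1: R(N) =
Σ_{2≤m≤N^{0.2}} log m·|Σ_{p≤N, m|p+h} μ((p+h)/m) log p| / N for h = 2 and h = 30030 (primorial
shift): should decay in N. (iii) lookup (done today as far as the outage allowed): a fixed-class
mean-square Ω-theorem at x/q ≥ exp((log x)^{1/2+η}) in FGHM 1991 / Granville–Soundararajan 2007 —
none found (Maier–Rassias survey §4–5 read: all irregularities live at x/q ≤ exp(β√(log x)/√(log log
x))). The gen-1 numerics of the card (h = 2, x ≤ 5·10^6: μ-signed dyadic sums ≤ 0.004x for D ≥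
x^{0.7}) are consistent with (i).

NUMBERS. Known levels: Bombieri–Vinogradov √N(log N)^{−B} (tree, proved); fixed-residue signed first
moments to x^{4/7−ε} (BFI 1986, well-factorable), x^{3/5−ε} (Maynard2020LargeModuliI, triply
well-factorable), absolute first moments Σ_{q≤Q,(q,a)=1}|ψ(x;q,a) − x/φ(q)| for fixed a only just
beyond √x by powers of log x (BFI-II/III 1987–89); all-classes variance asymptotic QN log Q for Q ≤
N (Montgomery–Hooley). Irregularities: FG 1989 Thm 1: Σ_{T<q<4T,(q,a)=1}|ψ(x;q,a) − x/φ(q)| ≫ x/log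
log x, T = x/(4 log^B x), every B > 1, a ≤ 2x a primorial multiple (kills uniform polylog co-level);
FG 1992 (part III): fixed a ≠ 0, Q^{1−1/log log Q} bad moduli in (Q,2Q] at x = q log^N q
(L²-harmless); FGHM 1991: BV-form fails at Q = x/exp((A−ε)(log log x)²/log log log x), Montgomery's
conjecture fails for q ≥ x·exp(−(log x)^{1/5−ε}); Granville–Soundararajan 2007: |Δ(x;ℓ,a)| ≥
y^{−δ(ℓ,y)} for (log ℓ)^{1+ε} ≤ y = x/ℓ ≤ exp(β√(log ℓ)/√(log log ℓ)) — all far below the power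
co-scales N^ε used here. Poisson size of V_t(D): ≍ N(log N)^t ≪ N²/(D(log N)^A) for D ≤ N(log
N)^{−A−t}. Trivial bound N²(log N)^{2t}/D, so cruxes 3/4 ask a saving (log N)^{A+2t}. Items at open:
11 (1 target, 3 cruxes, 1 assembly, 6 support); after route-repair rev 2: 7 (3 cruxes, 3 support, 1
assembly), route-file imports = gate defaults only (module cone: the Statement's own Literature
modules; 0 unproved facts beyond the Statement file's co-located conjecture defs). Fixed-shift
record (former FixedShiftPolylogExit): for fixed h ≥ 1, BDH-for-one-residue Σ_{D<d≤2D
sqfree,(d,h)=1}(ψ(y_d;d,h) − y_d/φ(d))² ≤ x²/(D(log x)^A) + x(log x)² on √x(log x)^{−B} ≤ D ≤ x/(log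
x)^3 plus the polylog atom Σ_{m≤(log x)^3} log m|Σ_{d≤x/m} μ(d)Λ(dm+h)| = o(x) give PairsHL(h)
(opening identity, PNT-rate Möbius series, BV below √x, Cauchy–Schwarz per dyadic block: ≤ 6x(log
x)^{2−A/2} + (31 log log x + 28)x(log x)^{−1/2}).

DEFINITION REQUESTS. None. Every constant exists (lean search --decl):
Literature.NumberTheory.Sieve.AffLinForm, .IsNondegenerateSystem, .affLinSize, .vonMangoldtSum,
.archFactor, .singularProduct, .realBox, .intVonMangoldt (LinearEquationsInPrimes.lean, imported by
the Statement), Literature.NumberTheory.Sieve.singularSeries (SingularSeries.lean; needed only by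
the dropped FixedShiftPolylogExit, so no route import remains after rev 2),
ArithmeticFunction.vonMangoldt(.residueClass), ArithmeticFunction.moebius, Int.gcd, Squarefree
(Mathlib). The class count T_q, the relative density ρ_Φ(q,c) and EH are inlined in the items (no
new notion, no module carrying an unproved named fact is imported).

Novelty: Searches (2026-08-15, this seat; `lit search` answered rc 75 (searchd) and OpenAlex/S2/arXiv HTTP
429 throughout the session, so the held-text + remote cascade was replaced by the galaxy corpora and
in-tree reading): `lit galaxy search "Barban-Davenport-Halberstam" --star all` (27 rows: BFI Acta
1986, Brüdern–Wooley 2011 sparse variance, Drappeau–Fiorilli 2020, Mastrostefano 2021, de la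
Bretèche–Fiorilli 2016, and the Pintz–Rassias volume 'Irregularities in the Distribution of Prime
Numbers' (isbn 9783030065140) → Maier–Rassias survey §4–5 READ via `lit galaxy read
panama:373138168741893 --chars 363949-380949`: FG 1989 Prop. 1 / Thm 1 / Thm 2, FG 1992 Corollary,
FGHM Thms A1–A2, Granville–Soundararajan Thms 5.3–5.4 with ranges); `--star all "twin primes in
arithmetic progressions"`, `"prime k-tuples in arithmetic progressions"`,
`"Barban-Davenport-Halberstam theorem for a fixed residue"` (0 rows each); `--star pdf --mode bm25`
×2 (15 rows each: M. R. Murty 'The twin prime problem and generalisations' READ p. 3 — the opening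
with Σ_{d≤x+2}E(x,d,−2) and 'even admitting EH the interval [x^{1−ε},x] still needs to be treated';
Granville's Riemann-anniversary survey; Kontorovich 'Levels of distribution and the affine sieve';
Baier–Zhao HL on average for quadratic progressions); in-tree: the 23 Theses files of the
sub-problem (esp. MobiusShiftedPrimes, PoissonVarianceAtom, DicksonFibration, PrimeDeterminantCells,
RoughSemiprimeRigidity), `ledger negatives --problem Parity` (2), the  [refs: paper:galaxy-pdf-9125150009983760040, MurtyVatwani2017, Vatwani2016, BombieriAsymptoticSieve1976, FriedlanderGoldston1996, FriedlanderGranville1989]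

Barriers (technique_class: cauchy-schwarz-in-modulus class-variance moebius-atom): - technique_class: cauchy-schwarz-in-modulus class-variance moebius-atom
- Literature.Barriers.Parity.SelbergParityBarrier: not evaded by the variance cruxes and not meant
to be — PrimeClassVariance / TupleClassVariance are weight-insertion-invariant equidistribution
statements with no parity content (provable-in-principle by dispersion); ALL parity sits in
MobiusCofactorAtom, a bilinear Möbius statement outside the Type-I class the barrier governs; the
bet is multiplicative number theory (MSP-type cancellation) there.
- Literature.Barriers.Parity.PrimePairParity: consistent — the route's non-sieve input is exactly
the bilinear/Möbius axiom Polymath name as what would break parity (Σ_d Σ_m α(d)β(m)Λ(dm+h) with α =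
μ); the Möbius-free cruxes alone cannot give twins and the route does not claim they do.
- Literature.Barriers.Parity.LargeSieveLevelHalf: bites on PrimeClassVariance / TupleClassVariance
for every D > N^{1/2+o(1)} (conceded: the large sieve controls only the all-classes variance);
evasion = the barrier's own evasions_known — dispersion/Kloosterman for a FIXED class (BFI 1986–89,
Maynard 2020) — and the cruxes ask one (worst) class per modulus in L²; CORRECTION (rev 2): with the
class function free this is NOT strictly less than EH — PrimeClassVariance ≍ Elliott–Halberstam over
squarefree moduli (refuter stmt-Parity-13834), so crux 3 is exactly EH-strength and the barrier's
verdict on EH is its verdict here.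
- Literature.Barriers.Parity.EquidistributionLimitBarrier:

History (route lifecycle, newest last):
- 2026-08-17T11:56:10Z · skeleton.hides-summit: stub_twoFlatFactors (stmt-Parity-0819) ⟷ summit (accepted theorem in Summits/Parity/GeneralizedHardyLittlewood/Theorems/DicksonFibrationDimOneEquivalence.lean) (prover-line-stmt-Parity-0819-c2-0)
- 2026-08-17T12:28:21Z · rev 3: restated Assembly (stmt-Parity-13841) — route-repair rev 2 step 2/4: new deciding theorem closes (hAt hV1 hVt hStep hBase hQG) — six binders, all items of this route, conclusion GeneralizedHardyLittle (planner-rbadge-Parity-ClassVarianceLadder-3468c376-0)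
- 2026-08-17T12:30:17Z · rev 4: dropped DimOne, FibrationLemma, QuantToDimOne, EHGivesPrimeClassVariance, FixedShiftPolylogExit — route-repair rev 2 step 3/4: drop DimOne/FibrationLemma/QuantToDimOne/EHGivesPrimeClassVariance/FixedShiftPolylogExit (none a binder of closes), imports := gate (planner-rbadge-Parity-ClassVarianceLadder-3468c376-0)
- 2026-08-25T12:46:07Z · DORMANT — reconciler: no traction for 7.7 d (last activity item-evidence-added at 2026-08-17T19:15:04Z); parked, not closed — `ledger route dormant route-Parity-ClassVari (operator:999:154794)

sub-problem: GeneralizedHardyLittlewood · status: dormant · opened planner-plancard-Parity-GeneralizedHardyLittl-c3157826-g2-0 2026-08-15T19:03:34Z · rev 5 · ledger route-Parity-ClassVarianceLadder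
GENERATED by the gate from the ledger (D-0016/17). Provers cite these decls: `theorem foo : Summit.Parity.GeneralizedHardyLittlewood.Theses.ClassVarianceLadder.<Decl> := …` in Summits/Parity/GeneralizedHardyLittlewood/Theorems/<Name>.lean.
-/

namespace Summit.Parity.GeneralizedHardyLittlewood.Theses.ClassVarianceLadder

open scoped BigOperators Topology Manifold Classical MeasureTheory ProbabilityTheory Matrix InnerProductSpace ComplexConjugate ContinuousMap
open Filter Set Function TopologicalSpace MeasureTheory

attribute [summit_statement] _root_.GeneralizedHardyLittlewood

/-- item stmt-Parity-13833 · crux · rank 2 · open · by planner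
why it might fail: It is Möbius-on-shifted-primes (open for every single m, h; Lichtman2020 only on average over shifts) for tuples, log-power saving, UNIFORM in shifts ≤ LN: under an exceptional zero mod q it fails at h ≡ 0 (q) (μ(d) ≈ −χ̄(m) along dm+h prime), so a proof entails Landau–Siegel repulsion.
sources: Literature.NumberTheory.Sieve.MoebiusShiftedPrimesConjecture, MurtyVatwani2017, Vatwani2016, Lichtman2020, LichtmanTeravainen2022, Harman2007
[crux] (card Crux 2, made shift-uniform, tuple-weighted and power-dilated) for every t ≥ 1, L and A
> 0 there are δ > 0 and N₀ such that for N ≥ N₀, every non-degenerate system Ψ of t+1 affine forms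
on ℤ with ‖Ψ‖_N ≤ L and every integer interval [u,v] ⊆ [−N,N]: Σ_{1 ≤ m ≤ N^δ} log m·|Σ_{n∈[u,v],
ψ_{t+1}(n) ≥ 1, m | ψ_{t+1}(n)} μ(ψ_{t+1}(n)/m)·Π_{i≤t} Λ(ψ_i(n))| ≤ N/(log N)^A (m = 1 carries
weight log 1 = 0). The Möbius function of the COFACTOR of the opened form does not correlate with
primality of the other t forms, ℓ¹ over dilations m ≤ N^δ: trivial mass ≍ δ²N(log N)²/2, so the
demand is a (log N)^{A+2} saving; t = 1, Ψ = (n, n+h) is Σ_{m≤N^δ} log m |Σ_{p≤N, m | p+h}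
μ((p+h)/m) log p| — the 0613/M_avg shape of MobiusShiftedPrimes, quantitative and uniform in |h| ≤
LN. [difficulty: open-problem] -/
@[route_item "route-Parity-ClassVarianceLadder", crux]
def MobiusCofactorAtom : Prop :=
  ∀ t : ℕ, 1 ≤ t → ∀ (L : ℕ) (A : ℝ), 0 < A → ∃ δ : ℝ, 0 < δ ∧ ∃ N₀ : ℕ, ∀ N : ℕ, N₀ ≤ N → ∀ Ψ : Fin (t + 1) → Literature.NumberTheory.Sieve.AffLinForm 1, Literature.NumberTheory.Sieve.IsNondegenerateSystem Ψ → Literature.NumberTheory.Sieve.affLinSize Ψ N ≤ L → ∀ u v : ℤ, -(N : ℤ) ≤ u → v ≤ N → ∑ m ∈ Finset.Icc 1 ⌊(N : ℝ) ^ δ⌋₊, Real.log m * |∑ n ∈ (Finset.Icc u v).filter (fun n : ℤ => 1 ≤ (Ψ (Fin.last t)).eval (fun _ => n) ∧ (m : ℤ) ∣ (Ψ (Fin.last t)).eval (fun _ => n)), (ArithmeticFunction.moebius (((Ψ (Fin.last t)).eval (fun _ => n)).toNat / m) : ℝ) * ∏ i : Fin t, Literature.NumberTheory.Sieve.intVonMangoldt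 ((Ψ (Fin.castSucc i)).eval fun _ => n)| ≤ (N : ℝ) / Real.log N ^ A

/-- item stmt-Parity-13834 · crux · rank 3 · open · by planner
why it might fail: ≍ Elliott–Halberstam over squarefree moduli (Cauchy–Schwarz: refuter stmt-Parity-13834): no worst-class mean square is known beyond √N(log N)^{−B} (BV); BFI x^{4/7} / Maynard x^{3/5} are signed, well-factorable, fixed-residue; at D = N^θ it is HL in aggregate over N^{2(1−θ)} < N slopes.
sources: ElliottHalberstam1970, Hooley1975BDH1, Hooley1977BDH7, Montgomery1971, FriedlanderGoldston1996, BombieriFriedlanderIwaniecActa1986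
[crux] (card Crux 1 at the power co-level forced by shift-uniformity) for every L, A, ε > 0,
eventually in N, for every non-degenerate one-form system φ(n) = a n + b (a ≠ 0, |a| + |b|/N ≤ L),
every scale 1 ≤ D ≤ N^{1−ε}, every class function c and interval choice [u_q, v_q] ⊆ [−N,N]:
Σ_{D<q≤2D, q squarefree} (Σ_{n∈[u_q,v_q], n≡c_q (q)} Λ(an+b) − ρ_φ(q,c_q)·Σ_{n∈[u_q,v_q]} Λ(an+b))²
≤ N²/(D(log N)^A), where ρ_φ(q,c) = 1[gcd(ac+b,q)=1]/#{r mod q : gcd(ar+b,q)=1} (= φ(|a|)/φ(|a|q) on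
coprime classes). Primes in ONE residue class per modulus, in mean square over the moduli, to level
N^{1−ε}: 'Barban–Davenport–Halberstam for a fixed class', the one-class L² shadow of
Elliott–Halberstam (EH ⟹ this: support EHGivesPrimeClassVariance), known for D ≤ √N(log N)^{−B} from
Bombieri–Vinogradov (tree, proved), Möbius-free. [difficulty: open-problem] -/
@[route_item "route-Parity-ClassVarianceLadder", crux]
def PrimeClassVariance : Prop :=
  ∀ (L : ℕ) (A ε : ℝ), 0 < A → 0 < ε → ∃ N₀ : ℕ, ∀ N : ℕ, N₀ ≤ N → ∀ Φ : Fin 1 → Literature.NumberTheory.Sieve.AffLinForm 1, Literature.NumberTheory.Sieve.IsNondegenerateSystem Φ → Literature.NumberTheory.Sieve.affLinSize Φ N ≤ L → ∀ D : ℝ, 1 ≤ D → D ≤ (N : ℝ) ^ (1 - ε) → ∀ c u v : ℕ → ℤ, (∀ q, -(N : ℤ) ≤ u q ∧ v q ≤ N) → ∑ q ∈ (Finset.Ioc ⌊D⌋₊ ⌊2 * D⌋₊).filter Squarefree, ((∑ n ∈ (Finset.Icc (u q) (v q)).filter (fun n : ℤ => ((q : ℕ) : ℤ) ∣ n - (c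 q)), ∏ i, Literature.NumberTheory.Sieve.intVonMangoldt ((Φ i).eval fun _ => n)) - ((if ∀ i, Int.gcd ((Φ i).eval fun _ => (c q)) q = 1 then (1 : ℝ) else 0) / ((((Finset.range q).filter fun r : ℕ => ∀ i, Int.gcd ((Φ i).eval fun _ => (r : ℤ)) q = 1).card : ℕ) : ℝ)) * (∑ n ∈ Finset.Icc (u q) (v q), ∏ i, Literature.NumberTheory.Sieve.intVonMangoldt ((Φ i).eval fun _ => n))) ^ 2 ≤ (N : ℝ) ^ 2 / (D * Real.log N ^ A)

/-- item stmt-Parity-13835 · crux · rank 4 · open · by planner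
why it might fail: Equidistribution of ACTUAL prime t-tuples among admissible classes is unknown at ANY growing modulus, even q ≤ log N for twins (no Siegel–Walfisz/BV for pairs); only the exact class-symmetry of the HL main terms and shift-averaged results (Kawada, MRT2019 with H ≥ X^{8/33}) support it.
sources: GreenTao2010, Dickson1904, Kawada1995, MatomakiRadziwillTao2019, Gallagher1976, GranvilleSoundararajan2007Uncertainty
[crux] for every t ≥ 2 the same relative mean square for prime t-tuples: for every L, A, ε > 0,
eventually in N, for every non-degenerate d = 1 system Φ of t forms with ‖Φ‖_N ≤ L, every 1 ≤ D ≤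
N^{1−ε}, every class function c and intervals [u_q,v_q] ⊆ [−N,N]: Σ_{D<q≤2D, q squarefree} (T_q(c_q)
− ρ_Φ(q,c_q)·T_1)² ≤ N²/(D(log N)^A), T_q(c) = Σ_{n∈[u_q,v_q], n≡c (q)} Π_i Λ(φ_i(n)), ρ_Φ(q,c) =
1[∀i gcd(φ_i(c),q)=1]/#{r mod q : ∀i gcd(φ_i(r),q)=1}. HL-FREE (the actual tuple count T_1 on the
same interval is the reference, not β_∞𝔖) and Möbius-free: 'prime t-tuples are equidistributed among
the q-admissible classes, in L² over q ∼ D, for all D ≤ N^{1−ε}' — the Siegel–Walfisz,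
Bombieri–Vinogradov and Elliott–Halberstam ranges for tuples at once, in the weakest (one class, L²,
relative) form the ladder needs; the HL main terms are EXACTLY uniform over admissible classes (β_ℓ
of the composed system n ↦ Φ(qn+c) is independent of the admissible c), so no singular-series
correction is hidden. [deps: PrimeClassVariance] [difficulty: open-problem] -/
@[route_item "route-Parity-ClassVarianceLadder", crux]
def TupleClassVariance : Prop :=
  ∀ t : ℕ, 2 ≤ t → ∀ (L : ℕ) (A ε : ℝ), 0 < A → 0 < ε → ∃ N₀ : ℕ, ∀ N : ℕ, N₀ ≤ N → ∀ Φ : Fin t → Literature.NumberTheory.Sieve.AffLinForm 1, Literature.NumberTheory.Sieve.IsNondegenerateSystem Φ → Literature.NumberTheory.Sieve.affLinSize Φ N ≤ L → ∀ D : ℝ, 1 ≤ D → D ≤ (N : ℝ) ^ (1 - ε) → ∀ c u v : ℕ → ℤ, (∀ q, -(N : ℤ) ≤ u q ∧ v q ≤ N) → ∑ q ∈ (Finset.Ioc ⌊D⌋₊ ⌊2 * D⌋₊).filter Squarefree, ((∑ n ∈ (Finset.Icc (u q) (v q)).filter (fun n : ℤ => ((q : ℕ) : ℤ) ∣ n -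 (c q)), ∏ i, Literature.NumberTheory.Sieve.intVonMangoldt ((Φ i).eval fun _ => n)) - ((if ∀ i, Int.gcd ((Φ i).eval fun _ => (c q)) q = 1 then (1 : ℝ) else 0) / ((((Finset.range q).filter fun r : ℕ => ∀ i, Int.gcd ((Φ i).eval fun _ => (r : ℤ)) q = 1).card : ℕ) : ℝ)) * (∑ n ∈ Finset.Icc (u q) (v q), ∏ i, Literature.NumberTheory.Sieve.intVonMangoldt ((Φ i).eval fun _ => n))) ^ 2 ≤ (N : ℝ) ^ 2 / (D * Real.log N ^ A)

/-- item stmt-Parity-13836 · support · rank 9 · open · by planner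
sources: BombieriAsymptoticSieve1976, MurtyVatwani2017, Vatwani2019, IwaniecKowalski2004, GreenTao2010
[support] PROVABLE bookkeeping (the card's CS reduction, for general t; est. XL in Lean): for every
t ≥ 1, Q_t → V_t → At_t → Q_{t+1}, where Q_t is quantitative Dickson–HL for t forms (∀ L A ∃ N₀:
|Σ_{n∈K}ΠΛ(φ_i(n)) − β_∞𝔖(Φ)| ≤ N/(log N)^A uniformly), V_t the class variance (PrimeClassVariance /
TupleClassVariance body at t) and At_t the atom body at t. Proof plan: (i) opening identity Λ =
μ⋆log on the last form and the split m ≤ N^δ (atom, bounded by At_t at saving A+1) / d ≤ 2LN^{1−δ};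
gcd(a_{t+1},b_{t+1}) > 1 ⇒ both sides ≪ (log N)^{t+2} (β_p = 0); else only d coprime to a_{t+1}
occur and {n : d | ψ_{t+1}(n)} is one class c_d mod d; (ii) F_d = ρ(d,c_d)·G_d + Fluct_d with G_d
the log-weighted full t-tuple sum, evaluated by Q_t (saving 2A+8) and partial summation; (iii) main
term Σ_d μ(d)ρ(d,c_d)G_d = β_∞𝔖(Ψ) + O(N(log N)^{−A−1}) by the multiplicative identity g(d) =
d·ρ(d,c_d), Σ_{d≤y} μ(d)g(d)/d ≪ (log y)^{−B} and −Σ_d μ(d)g(d)log d/d = Π_p β_p(Ψ)/β_p(Φ) (generic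
factor (1 − 1/(p−t))·p/(p−1) = β_p(Ψ)/β_p(Φ), checked), PNT-rate Möbius sums twisted by the tame g
uniformly in the ≤ t² log(LN) exceptional primes (tree: SiegelWalfiszMoebius_holds,
tendsto_singularProductPartial_hold -/
@[route_item "route-Parity-ClassVarianceLadder", crux]
def LadderStep : Prop :=
  ∀ t : ℕ, 1 ≤ t → (∀ (L : ℕ) (A : ℝ), 0 < A → ∃ N₀ : ℕ, ∀ N : ℕ, N₀ ≤ N → ∀ Φ : Fin t → Literature.NumberTheory.Sieve.AffLinForm 1, Literature.NumberTheory.Sieve.IsNondegenerateSystem Φ → Literature.NumberTheory.Sieve.affLinSize Φ N ≤ L → ∀ K : Set (Fin 1 → ℝ), Convex ℝ K → K ⊆ Literature.NumberTheory.Sieve.realBox 1 N → |Literature.NumberTheory.Sieve.vonMangoldtSum Φ K N - Literature.NumberTheory.Sieve.archFactor Φ K * Literature.NumberTheory.Sieve.singularProduct Φ| ≤ (N : ℝ) / Real.log N ^ A) → (∀ (L : ℕ) (A ε : ℝ), 0 < A → 0 < ε → ∃ N₀ : ℕ, ∀ N : ℕ, N₀ ≤ N → ∀ Φ : Fin t →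 Literature.NumberTheory.Sieve.AffLinForm 1, Literature.NumberTheory.Sieve.IsNondegenerateSystem Φ → Literature.NumberTheory.Sieve.affLinSize Φ N ≤ L → ∀ D : ℝ, 1 ≤ D → D ≤ (N : ℝ) ^ (1 - ε) → ∀ c u v : ℕ → ℤ, (∀ q, -(N : ℤ) ≤ u q ∧ v q ≤ N) → ∑ q ∈ (Finset.Ioc ⌊D⌋₊ ⌊2 * D⌋₊).filter Squarefree, ((∑ n ∈ (Finset.Icc (u q) (v q)).filter (fun n : ℤ => ((q : ℕ) : ℤ) ∣ n - (c q)), ∏ i, Literature.NumberTheory.Sieve.intVonMangoldt ((Φ i).eval fun _ => n)) - ((if ∀ i, Int.gcd ((Φ i).eval fun _ => (c q)) q = 1 then (1 : ℝ) else 0) / ((((Finset.range q).filter fun r : ℕ => ∀ i, Int.gcd ((Φ i).eval fun _ => (r : ℤ)) q = 1).card : ℕ) : ℝ)) * (∑ n ∈ Finset.Icc (u q) (v q), ∏ i, Literature.NumberTheory.Sieve.intVonMangoldt ((Φ i).eval fun _ => n))) ^ 2 ≤ (N : ℝ) ^ 2 / (D * Real.log N ^ A)) → (∀ (L : ℕ)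 (A : ℝ), 0 < A → ∃ δ : ℝ, 0 < δ ∧ ∃ N₀ : ℕ, ∀ N : ℕ, N₀ ≤ N → ∀ Ψ : Fin (t + 1) → Literature.NumberTheory.Sieve.AffLinForm 1, Literature.NumberTheory.Sieve.IsNondegenerateSystem Ψ → Literature.NumberTheory.Sieve.affLinSize Ψ N ≤ L → ∀ u v : ℤ, -(N : ℤ) ≤ u → v ≤ N → ∑ m ∈ Finset.Icc 1 ⌊(N : ℝ) ^ δ⌋₊, Real.log m * |∑ n ∈ (Finset.Icc u v).filter (fun n : ℤ => 1 ≤ (Ψ (Fin.last t)).eval (fun _ => n) ∧ (m : ℤ) ∣ (Ψ (Fin.last t)).eval (fun _ => n)), (ArithmeticFunction.moebius (((Ψ (Fin.last t)).eval (fun _ => n)).toNat / m) : ℝ) * ∏ i : Fin t, Literature.NumberTheory.Sieve.intVonMangoldt ((Ψ (Fin.castSucc i)).eval fun _ => n)| ≤ (N : ℝ) / Real.log N ^ A) → (∀ (L : ℕ) (A : ℝ), 0 < A → ∃ N₀ : ℕ, ∀ N : ℕ, N₀ ≤ N → ∀ Φ : Fin (t + 1) → Literature.NumberTheory.Sieve.AffLinForm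 1, Literature.NumberTheory.Sieve.IsNondegenerateSystem Φ → Literature.NumberTheory.Sieve.affLinSize Φ N ≤ L → ∀ K : Set (Fin 1 → ℝ), Convex ℝ K → K ⊆ Literature.NumberTheory.Sieve.realBox 1 N → |Literature.NumberTheory.Sieve.vonMangoldtSum Φ K N - Literature.NumberTheory.Sieve.archFactor Φ K * Literature.NumberTheory.Sieve.singularProduct Φ| ≤ (N : ℝ) / Real.log N ^ A)

/-- item stmt-Parity-13837 · support · rank 9 · open · by planner
sources: MontgomeryVaughan2007, GreenTao2010, IwaniecKowalski2004
[support] Q_1, PROVABLE NOW (est. M): for one non-constant form an + b with |a| + |b|/N ≤ L and an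
interval K ⊆ [−N,N], |Σ_{n∈K∩ℤ} Λ(an+b) − vol(K ∩ {au+b > 0})·𝔖| ≤ N/(log N)^A uniformly, 𝔖 =
singularProduct of the one-form system = 1[gcd(a,b)=1]·|a|/φ(|a|) (β_p = 1 for p ∤ a, p/(p−1) for p
| a ∤ b, 0 for p | (a,b)): the prime number theorem for the progression b mod |a| (bounded modulus ≤
L) on a value interval of length ≤ 2LN with error N·exp(−c√log N), from the tree's Siegel–Walfisz
theorem (Literature.NumberTheory.LFunctions.siegel_walfisz_holds) plus the evaluation of
localFactor/singularProduct for t = 1 (tendsto_singularProductPartial_holds) and archFactor = length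
of an interval. [difficulty: provable-now] -/
@[route_item "route-Parity-ClassVarianceLadder", crux]
def LadderBase : Prop :=
  ∀ (L : ℕ) (A : ℝ), 0 < A → ∃ N₀ : ℕ, ∀ N : ℕ, N₀ ≤ N → ∀ Φ : Fin 1 → Literature.NumberTheory.Sieve.AffLinForm 1, Literature.NumberTheory.Sieve.IsNondegenerateSystem Φ → Literature.NumberTheory.Sieve.affLinSize Φ N ≤ L → ∀ K : Set (Fin 1 → ℝ), Convex ℝ K → K ⊆ Literature.NumberTheory.Sieve.realBox 1 N → |Literature.NumberTheory.Sieve.vonMangoldtSum Φ K N - Literature.NumberTheory.Sieve.archFactor Φ K * Literature.NumberTheory.Sieve.singularProduct Φ| ≤ (N : ℝ) / Real.log N ^ A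

/-- item stmt-Parity-18167 · support · rank 9 · open · by planner
sources: GreenTao2010
[support] PROVABLE NOW (est. S; planner candidate proof attached as evidence, lean check rc 0, 0
sorries): quantitative Dickson–Hardy–Littlewood for every t ≥ 1 (error ≤ N/(log N)^A for every A >
0, uniform over non-degenerate d = 1 systems with ‖Φ‖_N ≤ L and convex K ⊆ [−N,N]) implies
GeneralizedHardyLittlewood. Proof: A = 1 and N ≥ exp(1/ε) give Green–Tao Conj. 1.2 at d = 1 with
error εN (the former support QuantToDimOne, stmt-Parity-13838, grounder proof rc 0), then the tree's
PROVED Theses-free fibration lemma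
Summit.Parity.GeneralizedHardyLittlewood.Theorems.FibrationGlue.generalizedHardyLittlewood_of_dimOne
(Theorems/LeeYangFibresFibrationLemmaFinal.lean; GreenTao2010 §1, remark after Conj. 1.2: 'holding d
− 1 of the variables fixed and summing in the remaining one'). CONE HYGIENE (route-repair rev 2 —
why this is ONE exit item and why the route file cites no theorem): land the proof in a fresh
Theorems file (e.g. Theorems/ClassVarianceLadderQuantToGHL.lean) importing ONLY
Summits.Parity.GeneralizedHardyLittlewood.Theorems.LeeYangFibresFibrationLemmaFinal (+ Mathlib,
HarnessLib) — never LeeYangFibresAssemblyClose, never a Theses.* module — so the route's module cone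
stays at -/
@[route_item "route-Parity-ClassVarianceLadder", crux]
def QuantToGHL : Prop :=
  (∀ t : ℕ, 1 ≤ t → ∀ (L : ℕ) (A : ℝ), 0 < A → ∃ N₀ : ℕ, ∀ N : ℕ, N₀ ≤ N → ∀ Φ : Fin t → Literature.NumberTheory.Sieve.AffLinForm 1, Literature.NumberTheory.Sieve.IsNondegenerateSystem Φ → Literature.NumberTheory.Sieve.affLinSize Φ N ≤ L → ∀ K : Set (Fin 1 → ℝ), Convex ℝ K → K ⊆ Literature.NumberTheory.Sieve.realBox 1 N → |Literature.NumberTheory.Sieve.vonMangoldtSum Φ K N - Literature.NumberTheory.Sieve.archFactor Φ K * Literature.NumberTheory.Sieve.singularProduct Φ| ≤ (N : ℝ) / Real.log N ^ A) → GeneralizedHardyLittlewood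

-- earlier Assembly (stmt-Parity-13841, replaced 2026-08-17T12:28:21Z -> stmt-Parity-18176): retired by None — MobiusCofactorAtom → PrimeClassVariance → TupleClassVariance → LadderStep → LadderBase → QuantToDimOne → FibrationLemma → GeneralizedHardyLittlewood
/-- item stmt-Parity-18176 · assembly · rank 1 · open · by planner
sources: GreenTao2010, BombieriAsymptoticSieve1976, HardyLittlewood1923
[assembly] MobiusCofactorAtom → PrimeClassVariance → TupleClassVariance → LadderStep → LadderBase →
QuantToGHL → GeneralizedHardyLittlewood (the type of `closes`, route-repair rev 2: the exit support
QuantToGHL replaces QuantToDimOne → FibrationLemma; `theorem Assembly_holds : Assembly := closes`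
closes it — candidate proof = `closes`, 0 sorries). Induction on the number of forms with
quantitative Dickson–HL Q_t as currency (Nat.le_induction: LadderBase = Q_1; LadderStep: Q_k ∧ V_k ∧
At_k → Q_{k+1} with V_1 = PrimeClassVariance, V_k = TupleClassVariance for k ≥ 2, At_k =
MobiusCofactorAtom at k), then QuantToGHL. [difficulty: provable-now] -/
@[route_item "route-Parity-ClassVarianceLadder"]
def Assembly : Prop :=
  MobiusCofactorAtom → PrimeClassVariance → TupleClassVariance → LadderStep → LadderBase → QuantToGHL → GeneralizedHardyLittlewood

-- records of items no longer active in this route (dropped / restated):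
-- earlier FibrationLemma (stmt-Parity-0822, dropped 2026-08-17T12:30:17Z): proved by Summit.Parity.GeneralizedHardyLittlewood.Theorems.leeYangFibres_fibrationLemma — DimOne → GeneralizedHardyLittlewood

/-! D-0027 §2.1 — DECIDING THEOREM (planner-authored via `route open/edit --closes-file`; by planner-rbadge-Parity-ClassVarianceLadder-3468c376-0 2026-08-17T12:28:21Z):
its hypotheses are this route's items and its conclusion the sub-problem Statement (glue_lint), and it elaborates with this file. -/

@[closes "route-Parity-ClassVarianceLadder"] theorem closes (hAt : MobiusCofactorAtom) (hV1 : PrimeClassVariance) (hVt : TupleClassVariance)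
    (hStep : LadderStep) (hBase : LadderBase) (hQG : QuantToGHL) :
    GeneralizedHardyLittlewood := by
  refine hQG ?_
  intro t ht
  induction t, ht using Nat.le_induction with
  | base => exact hBase
  | succ k hk ih =>
    refine hStep k hk ih ?_ (hAt k hk)
    rcases Nat.eq_or_lt_of_le hk with h | h
    · subst h
      exact hV1
    · exact hVt k h

end Summit.Parity.GeneralizedHardyLittlewood.Theses.ClassVarianceLadder
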